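import Summits.CriticalPhenomena.Ising3DConformalLimit.Theses.CurrentConnectionInvariance
import HarnessLib

/-!
# Skeleton (birth line) for piece 1 of the split of `NormalisedU4Nonvanishing`:
# `LimitExists` (item stmt-CriticalPhenomena-4738) — THIS ROUTE's plan: the telescoped reconstruction
# of the route's Assembly (item stmt-CriticalPhenomena-4845, parts (a)–(b)) from the two-point law (T)
# and the ratio limits (L)

Route `CurrentConnectionInvariance`, crux item stmt-CriticalPhenomena-4843; crux strategist
planner-cstrat-stmt-CriticalPhenomena-4843-r1-0, 2026-08-17.

The PRIMARY registered plan for item 4738 is its owner's line `Cruxes/LimitExists/Lines/birth`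
(two-point doubling ∧ two-point cluster uniqueness ∧ higher orders from the two-point function;
`ledger skeleton check` OK, sha 9217dc45).  This file records how THIS route reaches the same piece with
its OWN items, so that the split adds no new open statement to the route:

* `stub_twoPointLaw` = item stmt-CriticalPhenomena-0634 `IsingEuclidUpgradeR2RotInvPowerLaw` (T),
  verbatim the route decl: `⟨σ₀σ_x⟩_{β_c(3)}‖x‖^{2Δ} → c > 0`.  OPEN (rank 6 here, rank 2 of
  IsingEuclidUpgrade).
* `stub_ratioLimit` = item stmt-CriticalPhenomena-4841 `RatioLimit` (L), verbatim the route decl.  OPEN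
  (rank 3).
* `stub_reconstruction` — parts (a)–(b) of the route's Assembly item stmt-CriticalPhenomena-4845:
  `(T) → (L) → LimitExists` by `ρ(δ) := δ^{−Δ}`, `S 0 := 1`, `S odd := 0`, `S 2 := c‖x₀−x₁‖^{−2Δ}`,
  `S (n+2) := S n · S 2 / p_n` on the injective locus (the exact lattice telescoping
  `G_{n+2} = G_n G_2 / R_n` and locally uniform convergence of products/quotients).  PROVABLE NOW,
  size L (1–2 kLoC; all inputs are proved cone facts: `criticalTwoPoint_bounds_holds`,
  `criticalCorr_eq_zero_of_odd`, `plusCorr_shift`).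
* `LimitExists_of` — composition.
-/

namespace Summit.CriticalPhenomena.Ising3DConformalLimit.Cruxes.NormalisedU4Nonvanishing.SplitBirthLimit

open Summit.CriticalPhenomena.Ising3DConformalLimit.Theses.CurrentConnectionInvariance
  (IsingEuclidUpgradeR2RotInvPowerLaw RatioLimit)

/-- STUB 1 — the two-point law (T), item stmt-CriticalPhenomena-0634 verbatim. -/
theorem stub_twoPointLaw : IsingEuclidUpgradeR2RotInvPowerLaw := by
  sorry

/-- STUB 2 — the ratio limits (L), item stmt-CriticalPhenomena-4841 verbatim. -/
theorem stub_ratioLimit : RatioLimit := by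
  sorry

/-- STUB 3 — the telescoped reconstruction (Assembly item stmt-CriticalPhenomena-4845, parts (a)–(b)):
the two-point law and the ratio limits give a non-degenerate pointwise scaling limit. -/
theorem stub_reconstruction : IsingEuclidUpgradeR2RotInvPowerLaw → RatioLimit →
    ∃ (ρ : ℝ → ℝ) (S : Literature.Probability.LatticeModels.CorrFamily 3), (∀ δ ∈ Set.Ioc (0:ℝ) 1, 0 < ρ δ) ∧ Literature.Probability.LatticeModels.HasPointwiseScalingLimit (Literature.Probability.LatticeModels.criticalCorr 3) ρ S ∧ Literature.Probability.LatticeModels.IsNondegenerateTwoPoint S := by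
  sorry

/-- COMPOSITION: piece 1 `LimitExists` (item stmt-CriticalPhenomena-4738, verbatim) from the stubs. -/
theorem LimitExists_of
    (hT : IsingEuclidUpgradeR2RotInvPowerLaw) (hL : RatioLimit)
    (hR : IsingEuclidUpgradeR2RotInvPowerLaw → RatioLimit →
      ∃ (ρ : ℝ → ℝ) (S : Literature.Probability.LatticeModels.CorrFamily 3), (∀ δ ∈ Set.Ioc (0:ℝ) 1, 0 < ρ δ) ∧ Literature.Probability.LatticeModels.HasPointwiseScalingLimit (Literature.Probability.LatticeModels.criticalCorr 3) ρ S ∧ Literature.Probability.LatticeModels.IsNondegenerateTwoPoint S) :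
    ∃ (ρ : ℝ → ℝ) (S : Literature.Probability.LatticeModels.CorrFamily 3), (∀ δ ∈ Set.Ioc (0:ℝ) 1, 0 < ρ δ) ∧ Literature.Probability.LatticeModels.HasPointwiseScalingLimit (Literature.Probability.LatticeModels.criticalCorr 3) ρ S ∧ Literature.Probability.LatticeModels.IsNondegenerateTwoPoint S :=
  hR hT hL

/-- The skeleton concludes piece 1 from its stubs. -/
theorem LimitExists_of_stubs :
    ∃ (ρ : ℝ → ℝ) (S : Literature.Probability.LatticeModels.CorrFamily 3), (∀ δ ∈ Set.Ioc (0:ℝ) 1, 0 < ρ δ) ∧ Literature.Probability.LatticeModels.HasPointwiseScalingLimit (Literature.Probability.LatticeModels.criticalCorr 3) ρ S ∧ Literature.Probability.LatticeModels.IsNondegenerateTwoPoint S :=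
  LimitExists_of stub_twoPointLaw stub_ratioLimit stub_reconstruction

end Summit.CriticalPhenomena.Ising3DConformalLimit.Cruxes.NormalisedU4Nonvanishing.SplitBirthLimit
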